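import Literature.NumberTheory.Weil1964.LocalQuadraticGaussIntegral
import Mathlib.MeasureTheory.Group.Prod
import Mathlib.MeasureTheory.Integral.Prod
import HarnessLib

/-!
# The Weil index `γ(f) = g(f)/|g(f)|` of `f(x) = a x²` over a non-archimedean local field

Topic `NumberTheory/Weil1964`; namespace `Literature.NumberTheory.Weil1964`. KERNEL mathematics only
(one definition with body + theorems; no named fact, no `axiom`, no `sorry`). Sequel of
`LocalQuadraticGaussIntegral.lean` (`gaussBall ψ μ a n = g(f, 𝔭^n)`, `weilGauss ψ μ a = g(f)`).

For `ψ` of conductor exponent `d`, `‖a‖ = q^{-v}`, `‖2‖ = q^{-v₂}` and `n` in the stable range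
`2n ≤ d - v - 2v₂` we prove, by Fubini on `𝔭^n × 𝔭^n` and the shear `(x, y) ↦ (x, x + y)`,

  `g(f, 𝔭^n) · conj g(f, 𝔭^n) = μ(𝔭^n) · μ(𝔭^{d-n-v-v₂})`,

i.e. `|g(f)|² = q^{-(d-v-v₂)} μ(𝒪)² = selfDualConst(μ, d) · ‖2a‖⁻¹` — Weil's `|g(f)| = |ρ|^{-1/2}` for the
self-dual measure, `ρ = 2a` being the symmetric morphism of `f` ([Weil1964], Chap. I n° 14 Thm 2 and Cor. 2,
pp. 161–162, with Chap. II n° 27 p. 175: `γ(f) m(L) = g(f) |ρ|^{1/2}` up to the Haar normalisation). Hence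
`g(f) ≠ 0`, and **the Weil index**

  `weilIndex ψ μ a := g(f)/|g(f)|`   ([Weil1964], Chap. II n° 27, last display p. 175)

has absolute value `1` (n° 24 p. 173), does not depend on the Haar measure (n° 24 p. 173: "ne dépend pas du
choix des mesures de Haar"), satisfies `γ(-f) = conj γ(f) = γ(f)⁻¹` (n° 25 p. 173), `γ(f ∘ b) = γ(f)` for the
equivalent form `(a b²) x²` (n° 25 p. 173), and equals `1` in the unramified case `d = 0`, `‖a‖ = ‖2‖ = 1`
(n° 27: the Gauss sum reduces to the term `x = 0`).

NOT here (the next items of the programme): `γ(f)⁸ = 1` and the Hilbert-symbol law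
`γ(ab)γ(1) = γ(a)γ(b)(a,b)` ([Weil1964] n° 28 Prop. 4 and (28)), the archimedean index, and `γ` of a general
quadratic space (by n° 25 Prop. 3 the diagonal case is the product of the one-variable indices).

## References

* [Weil1964] A. Weil, *Sur certains groupes d'opérateurs unitaires*, Acta Math. 111 (1964) 143–211, Chap. I n° 14
  (Thm 2, Cor. 1–2, pp. 161–162), Chap. II n° 24–25 (p. 173), n° 27 (pp. 174–175).
-/

set_option autoImplicit false

noncomputable section

open MeasureTheory ValuativeRel Filter Topology Set
open scoped NNReal ENNReal Pointwise
open Literature.NumberTheory.GaloisRepresentations.IsNonarchimedeanLocalField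
open Literature.NumberTheory.Automorphic

namespace Literature.NumberTheory.Weil1964

variable {F : Type*} [Field F] [ValuativeRel F] [TopologicalSpace F] [IsNonarchimedeanLocalField F]
variable [MeasurableSpace F]

/-- **The Weil index** `γ(f) = g(f)/|g(f)|` of the quadratic form `f(x) = a x²` over the non-archimedean local
field `F`, relative to the character `ψ` (computed with the Haar measure `μ`, of which it is independent:
`weilIndex_eq_of_isAddHaarMeasure`); a complex number of absolute value `1` (`norm_weilIndex`). For `a = 0` or in
characteristic `2` (degenerate forms) the value is a junk value. [cite: Weil1964, Chap. II n° 27, p. 175] -/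
def weilIndex (ψ : AddChar F Circle) (μ : Measure F) (a : F) : ℂ :=
  weilGauss ψ μ a / (‖weilGauss ψ μ a‖ : ℂ)

variable [BorelSpace F] (μ : Measure F) [μ.IsAddHaarMeasure] {ψ : AddChar F Circle}

/-! ## §1 `|g(f, 𝔭^n)|²` by Fubini -/

section Modulus

/-- **`g(f, 𝔭^n) · conj g(f, 𝔭^n) = μ(𝔭^n) μ(𝔭^{d-n-v-v₂})`** on the stable range `2n ≤ d - v - 2v₂`:
write the product as a double integral over `𝔭^n × 𝔭^n`, shear `(x, y) ↦ (x, x + y)`, integrate the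
character `x ↦ ψ(-2axy)` over `𝔭^n` first (it gives `μ(𝔭^n) · [y ∈ 𝔭^{d-n-v-v₂}]`), then `ψ(-a y²) = 1` on
`𝔭^{d-n-v-v₂} ⊆ 𝔭^n`. This is Weil's `|g(f)| = |ρ|^{-1/2} m(L)` (Cor. 2 of Thm 2 applied to `Φ = φ_L`).
[cite: Weil1964, Chap. I n° 14 Thm 2 Cor. 2, p. 162; Chap. II n° 27, p. 175] -/
theorem gaussBall_mul_conj {d : ℤ} (hd : ψ.HasConductorExp d) {a : F} {v : ℤ}
    (ha : normAbs F a = (residueFieldCard F : ℝ≥0)⁻¹ ^ v) {v₂ : ℤ}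
    (h2 : normAbs F (2 : F) = (residueFieldCard F : ℝ≥0)⁻¹ ^ v₂) {n : ℤ} (hn : 2 * n ≤ d - v - 2 * v₂) :
    gaussBall ψ μ a n * (starRingEnd ℂ) (gaussBall ψ μ a n) =
      (μ.real (primePowBall F n) : ℂ) * μ.real (primePowBall F (d - n - v - v₂)) := by
  haveI : T2Space F :=
    (Literature.NumberTheory.GaloisRepresentations.IsNonarchimedeanLocalField.isLocalField F).toT2Space
  haveI : LocallyCompactSpace F :=
    (Literature.NumberTheory.GaloisRepresentations.IsNonarchimedeanLocalField.isLocalField F).toLocallyCompactSpace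
  haveI : SecondCountableTopology F := secondCountableTopology_localField F
  have hψ : Continuous ψ := continuous_of_hasConductorExp hd
  have hv₂ : 0 ≤ v₂ := nonneg_of_normAbs_two_eq h2
  set S : Set F := primePowBall F n with hSdef
  set T : Set F := primePowBall F (d - n - v - v₂) with hTdef
  have hS : MeasurableSet S := measurableSet_primePowBall n
  have hT : MeasurableSet T := measurableSet_primePowBall _
  have hTS : T ⊆ S := primePowBall_antitone (by omega)
  have hSfin : μ S < ∞ := measure_primePowBall_lt_top μ n
  have h2a : normAbs F (2 * a) = (residueFieldCard F : ℝ≥0)⁻¹ ^ (v₂ + v) := by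
    rw [map_mul, h2, ha, zpow_add₀ inv_residueFieldCard_pos.ne']
  have hcT : ∀ y : F, -(2 * a * y) ∈ primePowBall F (d - n) ↔ y ∈ T := by
    intro y
    rw [show -(2 * a * y) = (2 * a) * (-y) by ring, mul_mem_primePowBall_iff h2a,
      show d - n - (v₂ + v) = d - n - v - v₂ by ring]
    exact ⟨fun h => by simpa using neg_mem_primePowBall h, fun h => neg_mem_primePowBall h⟩
  have hψT : ∀ y ∈ T, psiSq ψ (-a) y = 1 := by
    intro y hy
    have hav : -a ∈ primePowBall F v := by rw [mem_primePowBall_iff, normAbs_neg, ha]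
    have h3 := mul_mem_primePowBall (mul_mem_primePowBall hav hy) hy
    rw [show -a * y * y = -a * y ^ 2 by ring] at h3
    rw [psiSq, hd.1 _ (primePowBall_antitone (by omega) h3), Circle.coe_one]
  -- pointwise algebra: `ψ(a x²) ψ(-a (x+y)²) = ψ(-a y²) ψ(x · (-2 a y))`
  have halg : ∀ x y : F,
      psiSq ψ a x * psiSq ψ (-a) (x + y) = psiSq ψ (-a) y * ((ψ (x * -(2 * a * y)) : Circle) : ℂ) := by
    intro x y
    simp only [psiSq]
    rw [← Circle.coe_mul, ← AddChar.map_add_eq_mul, ← Circle.coe_mul, ← AddChar.map_add_eq_mul]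
    congr 2
    ring
  -- the sheared integrand `H(x, y) = 1_{S×S}(x, y) ψ(-a y²) ψ(x · (-2 a y))`
  have hGH : (fun z : F × F => (S ×ˢ S).indicator (fun z : F × F => psiSq ψ a z.1 * psiSq ψ (-a) z.2)
        (z.1, z.1 + z.2)) =
      (S ×ˢ S).indicator fun z : F × F => psiSq ψ (-a) z.2 * ((ψ (z.1 * -(2 * a * z.2)) : Circle) : ℂ) := by
    funext z
    by_cases hx : z.1 ∈ S
    · by_cases hy : z.2 ∈ S
      · have h1 : (z.1, z.1 + z.2) ∈ S ×ˢ S := Set.mk_mem_prod hx (add_mem_primePowBall hx hy)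
        have h1' : z ∈ S ×ˢ S := Set.mk_mem_prod hx hy
        rw [Set.indicator_of_mem h1, Set.indicator_of_mem h1']
        exact halg z.1 z.2
      · have h1 : (z.1, z.1 + z.2) ∉ S ×ˢ S := fun h => hy (by
          have h' := add_mem_primePowBall (neg_mem_primePowBall hx) (Set.mem_prod.1 h).2
          rwa [neg_add_cancel_left] at h')
        rw [Set.indicator_of_notMem h1, Set.indicator_of_notMem (fun h => hy (Set.mem_prod.1 h).2)]
    · have h1 : (z.1, z.1 + z.2) ∉ S ×ˢ S := fun h => hx (Set.mem_prod.1 h).1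
      rw [Set.indicator_of_notMem h1, Set.indicator_of_notMem (fun h => hx (Set.mem_prod.1 h).1)]
  -- integrability of `H`
  have hHc : Continuous fun z : F × F => psiSq ψ (-a) z.2 * ((ψ (z.1 * -(2 * a * z.2)) : Circle) : ℂ) :=
    ((continuous_psiSq hψ (-a)).comp continuous_snd).mul
      (continuous_subtype_val.comp (hψ.comp (continuous_fst.mul (continuous_const.mul continuous_snd).neg)))
  have hHint : Integrable ((S ×ˢ S).indicator fun z : F × F =>
      psiSq ψ (-a) z.2 * ((ψ (z.1 * -(2 * a * z.2)) : Circle) : ℂ)) (μ.prod μ) := by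
    have hfin : (μ.prod μ) (S ×ˢ S) ≠ ∞ := by
      rw [Measure.prod_prod]; exact ENNReal.mul_ne_top hSfin.ne hSfin.ne
    have hon : IntegrableOn (fun z : F × F => psiSq ψ (-a) z.2 * ((ψ (z.1 * -(2 * a * z.2)) : Circle) : ℂ))
        (S ×ˢ S) (μ.prod μ) :=
      Measure.integrableOn_of_bounded (M := 1) hfin hHc.aestronglyMeasurable
        (Eventually.of_forall fun z => by rw [norm_mul, norm_psiSq, one_mul, Circle.norm_coe])
    exact hon.integrable_indicator (hS.prod hS)
  -- the inner integrals (integrate `x` first)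
  have hinner : ∀ y : F, ∫ x, (S ×ˢ S).indicator (fun z : F × F =>
        psiSq ψ (-a) z.2 * ((ψ (z.1 * -(2 * a * z.2)) : Circle) : ℂ)) (x, y) ∂μ =
      T.indicator (fun _ => (μ.real S : ℂ)) y := by
    intro y
    by_cases hy : y ∈ S
    · have e1 : (fun x => (S ×ˢ S).indicator (fun z : F × F =>
            psiSq ψ (-a) z.2 * ((ψ (z.1 * -(2 * a * z.2)) : Circle) : ℂ)) (x, y)) =
          S.indicator (fun x => psiSq ψ (-a) y * ((ψ (x * -(2 * a * y)) : Circle) : ℂ)) := by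
        funext x
        by_cases hx : x ∈ S
        · rw [Set.indicator_of_mem (Set.mk_mem_prod hx hy), Set.indicator_of_mem hx]
        · rw [Set.indicator_of_notMem (fun h => hx (Set.mem_prod.1 h).1), Set.indicator_of_notMem hx]
      rw [e1, integral_indicator hS, integral_const_mul,
        setIntegral_primePowBall_addChar_mul μ hd n (-(2 * a * y))]
      by_cases hyT : y ∈ T
      · rw [if_pos ((hcT y).2 hyT), Set.indicator_of_mem hyT, hψT y hyT, one_mul]
      · rw [if_neg (fun h => hyT ((hcT y).1 h)), Set.indicator_of_notMem hyT, mul_zero]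
    · have e1 : (fun x => (S ×ˢ S).indicator (fun z : F × F =>
            psiSq ψ (-a) z.2 * ((ψ (z.1 * -(2 * a * z.2)) : Circle) : ℂ)) (x, y)) = fun _ => 0 := by
        funext x
        rw [Set.indicator_of_notMem (fun h => hy (Set.mem_prod.1 h).2)]
      rw [e1, integral_zero, Set.indicator_of_notMem (fun h => hy (hTS h))]
  -- the shear is measure preserving
  have hmp : MeasurePreserving (fun z : F × F => (z.1, z.1 + z.2)) (μ.prod μ) (μ.prod μ) :=
    measurePreserving_prod_add μ μ
  have hemb : MeasurableEmbedding (fun z : F × F => (z.1, z.1 + z.2)) :=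
    (MeasurableEquiv.shearAddRight F).measurableEmbedding
  calc gaussBall ψ μ a n * (starRingEnd ℂ) (gaussBall ψ μ a n)
      = gaussBall ψ μ a n * gaussBall ψ μ (-a) n := by rw [gaussBall_neg]
    _ = ∫ z in S ×ˢ S, psiSq ψ a z.1 * psiSq ψ (-a) z.2 ∂(μ.prod μ) := by
        rw [gaussBall_def, gaussBall_def]
        exact (setIntegral_prod_mul _ _ S S).symm
    _ = ∫ z, (S ×ˢ S).indicator (fun z : F × F => psiSq ψ a z.1 * psiSq ψ (-a) z.2) z ∂(μ.prod μ) :=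
        (integral_indicator (hS.prod hS)).symm
    _ = ∫ z, (S ×ˢ S).indicator (fun z : F × F => psiSq ψ a z.1 * psiSq ψ (-a) z.2)
          (z.1, z.1 + z.2) ∂(μ.prod μ) := (hmp.integral_comp hemb _).symm
    _ = ∫ z, (S ×ˢ S).indicator (fun z : F × F =>
          psiSq ψ (-a) z.2 * ((ψ (z.1 * -(2 * a * z.2)) : Circle) : ℂ)) z ∂(μ.prod μ) := by rw [hGH]
    _ = ∫ y, ∫ x, (S ×ˢ S).indicator (fun z : F × F =>
          psiSq ψ (-a) z.2 * ((ψ (z.1 * -(2 * a * z.2)) : Circle) : ℂ)) (x, y) ∂μ ∂μ :=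
        integral_prod_symm _ hHint
    _ = ∫ y, T.indicator (fun _ => (μ.real S : ℂ)) y ∂μ := integral_congr_ae (Eventually.of_forall hinner)
    _ = (μ.real (primePowBall F n) : ℂ) * μ.real (primePowBall F (d - n - v - v₂)) := by
        rw [integral_indicator_const _ hT, Complex.real_smul, mul_comm]

/-- **`|g(f, 𝔭^n)|² = μ(𝔭^n) μ(𝔭^{d-n-v-v₂})`** on the stable range.
[cite: Weil1964, Chap. I n° 14 Thm 2 Cor. 2, p. 162; Chap. II n° 27, p. 175] -/
theorem norm_sq_gaussBall {d : ℤ} (hd : ψ.HasConductorExp d) {a : F} {v : ℤ}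
    (ha : normAbs F a = (residueFieldCard F : ℝ≥0)⁻¹ ^ v) {v₂ : ℤ}
    (h2 : normAbs F (2 : F) = (residueFieldCard F : ℝ≥0)⁻¹ ^ v₂) {n : ℤ} (hn : 2 * n ≤ d - v - 2 * v₂) :
    ‖gaussBall ψ μ a n‖ ^ 2 = μ.real (primePowBall F n) * μ.real (primePowBall F (d - n - v - v₂)) := by
  have h := gaussBall_mul_conj μ hd ha h2 hn
  rw [Complex.mul_conj'] at h
  exact_mod_cast h

/-- **`|g(f)|² = q^{-(d - v - v₂)} μ(𝒪)²`**: the modulus of Weil's stable Gauss integral.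
[cite: Weil1964, Chap. I n° 14 Thm 2 Cor. 2, p. 162; Chap. II n° 27, p. 175] -/
theorem norm_sq_weilGauss {d : ℤ} (hd : ψ.HasConductorExp d) {a : F} {v : ℤ}
    (ha : normAbs F a = (residueFieldCard F : ℝ≥0)⁻¹ ^ v) {v₂ : ℤ}
    (h2 : normAbs F (2 : F) = (residueFieldCard F : ℝ≥0)⁻¹ ^ v₂) :
    ‖weilGauss ψ μ a‖ ^ 2 =
      ((residueFieldCard F : ℝ)⁻¹) ^ (d - v - v₂) * μ.real (primePowBall F 0) ^ 2 := by
  obtain ⟨n₀, hn₀⟩ : ∃ n₀ : ℤ, 2 * n₀ ≤ d - v - 2 * v₂ := ⟨min (d - v - 2 * v₂) 0, by omega⟩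
  have hq : (residueFieldCard F : ℝ)⁻¹ ≠ 0 := inv_ne_zero (Nat.cast_ne_zero.2 (residueFieldCard_ne_zero F))
  rw [weilGauss_eq_gaussBall μ hd ha h2 hn₀, norm_sq_gaussBall μ hd ha h2 hn₀,
    LocalFieldHaar.measureReal_primePowBall μ n₀, LocalFieldHaar.measureReal_primePowBall μ (d - n₀ - v - v₂),
    show d - v - v₂ = n₀ + (d - n₀ - v - v₂) by ring, zpow_add₀ hq]
  ring

/-- **Weil's normalisation `|g(f)| = |ρ|^{-1/2}`** in the tree's bookkeeping: `|g(f)|² = selfDualConst(μ, d) · ‖2a‖⁻¹`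
(`selfDualConst μ d = q^{-d} μ(𝒪)²` is `1` exactly for the self-dual measure; `ρ = 2a`).
[cite: Weil1964, Chap. I n° 14 Thm 2 Cor. 2, p. 162; Chap. II n° 27, p. 175] -/
theorem norm_sq_weilGauss_eq_selfDualConst_mul {d : ℤ} (hd : ψ.HasConductorExp d) {a : F} {v : ℤ}
    (ha : normAbs F a = (residueFieldCard F : ℝ≥0)⁻¹ ^ v) {v₂ : ℤ}
    (h2 : normAbs F (2 : F) = (residueFieldCard F : ℝ≥0)⁻¹ ^ v₂) :
    ‖weilGauss ψ μ a‖ ^ 2 = selfDualConst μ d * ((normAbs F (2 * a))⁻¹ : ℝ≥0) := by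
  have hq : (residueFieldCard F : ℝ)⁻¹ ≠ 0 := inv_ne_zero (Nat.cast_ne_zero.2 (residueFieldCard_ne_zero F))
  rw [norm_sq_weilGauss μ hd ha h2, selfDualConst, map_mul, h2, ha, ← zpow_add₀ inv_residueFieldCard_pos.ne',
    ← zpow_neg, NNReal.coe_zpow, NNReal.coe_inv, NNReal.coe_natCast,
    show d - v - v₂ = d + -(v₂ + v) by ring, zpow_add₀ hq]
  ring

/-- **`g(f) ≠ 0`** (for `ψ` continuous non-trivial, `a ≠ 0`, `2 ≠ 0`). [cite: Weil1964, Chap. II n° 27, p. 175] -/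
theorem weilGauss_ne_zero (hψ : ψ.IsContinuousNontrivial) {a : F} (ha : a ≠ 0) (htwo : (2 : F) ≠ 0) :
    weilGauss ψ μ a ≠ 0 := by
  obtain ⟨d, v, v₂, hd, hv, hv₂⟩ := exists_exponents hψ ha htwo
  have hpos : 0 < ‖weilGauss ψ μ a‖ ^ 2 := by
    rw [norm_sq_weilGauss μ hd hv hv₂]
    exact mul_pos (zpow_pos (inv_pos.2 (Nat.cast_pos.2 (Nat.pos_of_ne_zero (residueFieldCard_ne_zero F)))) _)
      (pow_pos (LocalFieldHaar.measureReal_primePowBall_pos μ 0) 2)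
  intro h
  rw [h, norm_zero] at hpos
  norm_num at hpos

/-- `0 < |g(f)|`. [cite: Weil1964, Chap. II n° 27, p. 175] -/
theorem norm_weilGauss_pos (hψ : ψ.IsContinuousNontrivial) {a : F} (ha : a ≠ 0) (htwo : (2 : F) ≠ 0) :
    0 < ‖weilGauss ψ μ a‖ :=
  norm_pos_iff.2 (weilGauss_ne_zero μ hψ ha htwo)

end Modulus

/-! ## §2 The Weil index -/

section Index

omit [BorelSpace F] [μ.IsAddHaarMeasure] in
/-- unfolding. [cite: Weil1964, Chap. II n° 27, p. 175] -/
theorem weilIndex_def (a : F) : weilIndex ψ μ a = weilGauss ψ μ a / (‖weilGauss ψ μ a‖ : ℂ) := rfl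

/-- **`|γ(f)| = 1`**. [cite: Weil1964, Chap. II n° 24, p. 173] -/
theorem norm_weilIndex (hψ : ψ.IsContinuousNontrivial) {a : F} (ha : a ≠ 0) (htwo : (2 : F) ≠ 0) :
    ‖weilIndex ψ μ a‖ = 1 := by
  rw [weilIndex, norm_div, Complex.norm_real, norm_norm,
    div_self (norm_ne_zero_iff.2 (weilGauss_ne_zero μ hψ ha htwo))]

/-- **`g(f) = γ(f) |g(f)|`** (Weil's `γ(f) m(L) = g(f) · (positive real)`). [cite: Weil1964, Chap. II n° 27, p. 175] -/
theorem weilGauss_eq_weilIndex_mul_norm (hψ : ψ.IsContinuousNontrivial) {a : F} (ha : a ≠ 0)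
    (htwo : (2 : F) ≠ 0) : weilGauss ψ μ a = weilIndex ψ μ a * (‖weilGauss ψ μ a‖ : ℂ) := by
  have h : (‖weilGauss ψ μ a‖ : ℂ) ≠ 0 :=
    Complex.ofReal_ne_zero.2 (norm_ne_zero_iff.2 (weilGauss_ne_zero μ hψ ha htwo))
  rw [weilIndex, div_mul_cancel₀ _ h]

/-- **`γ(-f) = conj γ(f)`** (`χ ∘ (-f)` is the conjugate of `χ ∘ f`). [cite: Weil1964, Chap. II n° 25, p. 173] -/
theorem weilIndex_neg (hψ : ψ.IsContinuousNontrivial) {a : F} (ha : a ≠ 0) (htwo : (2 : F) ≠ 0) :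
    weilIndex ψ μ (-a) = (starRingEnd ℂ) (weilIndex ψ μ a) := by
  rw [weilIndex, weilIndex, weilGauss_neg μ hψ ha htwo, Complex.norm_conj, map_div₀, Complex.conj_ofReal]

/-- **`γ(-f) γ(f) = 1`**, i.e. `γ(-f) = γ(f)⁻¹`. [cite: Weil1964, Chap. II n° 25, p. 173] -/
theorem weilIndex_neg_mul_self (hψ : ψ.IsContinuousNontrivial) {a : F} (ha : a ≠ 0) (htwo : (2 : F) ≠ 0) :
    weilIndex ψ μ (-a) * weilIndex ψ μ a = 1 := by
  rw [weilIndex_neg μ hψ ha htwo, Complex.conj_mul', norm_weilIndex μ hψ ha htwo]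
  norm_num

/-- **equivalent forms have the same index**: `γ((a b²) x²) = γ(a x²)` for `b ≠ 0` — first the Gauss integrals:
`g(a b²) = ‖b‖⁻¹ g(a)`. [cite: Weil1964, Chap. II n° 25, p. 173] -/
theorem weilGauss_mul_sq (hψ : ψ.IsContinuousNontrivial) {a : F} (ha : a ≠ 0) (htwo : (2 : F) ≠ 0)
    {b : F} (hb : b ≠ 0) :
    weilGauss ψ μ (a * b ^ 2) = (((normAbs F b)⁻¹ : ℝ≥0) : ℂ) * weilGauss ψ μ a := by
  obtain ⟨d, v, v₂, hd, hv, hv₂⟩ := exists_exponents hψ ha htwo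
  obtain ⟨k, hk⟩ := exists_normAbs_eq_inv_zpow hb
  have hab : normAbs F (a * b ^ 2) = (residueFieldCard F : ℝ≥0)⁻¹ ^ (v + 2 * k) := by
    rw [map_mul, map_pow, hv, hk, ← zpow_natCast, ← zpow_mul, zpow_add₀ inv_residueFieldCard_pos.ne']
    congr 1
    rw [mul_comm]
    rfl
  obtain ⟨n₀, hn₀⟩ : ∃ n₀ : ℤ, 2 * n₀ ≤ d - (v + 2 * k) - 2 * v₂ :=
    ⟨min (d - (v + 2 * k) - 2 * v₂) 0, by omega⟩
  rw [weilGauss_eq_gaussBall μ hd hab hv₂ hn₀, gaussBall_mul_sq μ a hk n₀,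
    weilGauss_eq_gaussBall μ hd hv hv₂ (n₀ := n₀ + k) (by omega)]

/-- **`γ(f ∘ b) = γ(f)`**: `γ((a b²) x²) = γ(a x²)` for `b ≠ 0` — the index depends on `a` only through its class
modulo squares. [cite: Weil1964, Chap. II n° 25, p. 173] -/
theorem weilIndex_mul_sq (hψ : ψ.IsContinuousNontrivial) {a : F} (ha : a ≠ 0) (htwo : (2 : F) ≠ 0)
    {b : F} (hb : b ≠ 0) : weilIndex ψ μ (a * b ^ 2) = weilIndex ψ μ a := by
  have hc : (0 : ℝ) < ((normAbs F b)⁻¹ : ℝ≥0) := by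
    have hb' : 0 < normAbs F b := pos_iff_ne_zero.2 fun h => hb ((map_eq_zero (normAbs F)).1 h)
    exact_mod_cast inv_pos.2 hb'
  have hc' : ((((normAbs F b)⁻¹ : ℝ≥0) : ℝ) : ℂ) ≠ 0 := Complex.ofReal_ne_zero.2 hc.ne'
  rw [weilIndex, weilIndex, weilGauss_mul_sq μ hψ ha htwo hb, norm_mul, Complex.norm_real,
    Real.norm_of_nonneg hc.le, Complex.ofReal_mul, mul_div_mul_left _ _ hc']

/-- **the unramified value `γ(f) = 1`**: `ψ` of conductor exponent `0`, `a` a unit, `q` odd (`‖2‖ = 1`); then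
`g(f) = μ(𝒪) > 0`. [cite: Weil1964, Chap. II n° 27, p. 175] -/
theorem weilIndex_of_unramified (hd : ψ.HasConductorExp 0) {a : F} (ha : normAbs F a = 1)
    (h2 : normAbs F (2 : F) = 1) : weilIndex ψ μ a = 1 := by
  have hpos : 0 < μ.real (primePowBall F 0) := LocalFieldHaar.measureReal_primePowBall_pos μ 0
  rw [weilIndex, weilGauss_of_unramified μ hd ha h2, Complex.norm_real, Real.norm_of_nonneg hpos.le,
    div_self (Complex.ofReal_ne_zero.2 hpos.ne')]

omit [BorelSpace F] [μ.IsAddHaarMeasure] in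
/-- **independence of the Haar measure**: the Gauss integrals scale, `g_{c μ}(f, M) = c · g_μ(f, M)`.
[cite: Weil1964, Chap. II n° 24, p. 173] -/
theorem gaussBall_smul_measure (c : ℝ≥0) (a : F) (n : ℤ) :
    gaussBall ψ (c • μ) a n = (c : ℂ) * gaussBall ψ μ a n := by
  rw [gaussBall_def, gaussBall_def, Measure.restrict_smul, integral_smul_nnreal_measure, NNReal.smul_def,
    Complex.real_smul]

/-- **`γ(f)` does not depend on the choice of the Haar measure** ("changing the measures modifies the formulas
of Thm 2 and its corollaries only by real factors `> 0`"). [cite: Weil1964, Chap. II n° 24, p. 173] -/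
theorem weilIndex_eq_of_isAddHaarMeasure (μ' : Measure F) [μ'.IsAddHaarMeasure] (hψ : ψ.IsContinuousNontrivial)
    {a : F} (ha : a ≠ 0) (htwo : (2 : F) ≠ 0) : weilIndex ψ μ' a = weilIndex ψ μ a := by
  haveI : T2Space F :=
    (Literature.NumberTheory.GaloisRepresentations.IsNonarchimedeanLocalField.isLocalField F).toT2Space
  haveI : LocallyCompactSpace F :=
    (Literature.NumberTheory.GaloisRepresentations.IsNonarchimedeanLocalField.isLocalField F).toLocallyCompactSpace
  haveI : SecondCountableTopology F := secondCountableTopology_localField F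
  obtain ⟨d, v, v₂, hd, hv, hv₂⟩ := exists_exponents hψ ha htwo
  obtain ⟨n₀, hn₀⟩ : ∃ n₀ : ℤ, 2 * n₀ ≤ d - v - 2 * v₂ := ⟨min (d - v - 2 * v₂) 0, by omega⟩
  set c : ℝ≥0 := Measure.addHaarScalarFactor μ' μ with hcdef
  have hμ' : μ' = c • μ := Measure.isAddLeftInvariant_eq_smul μ' μ
  have hc : 0 < (c : ℝ) := by
    have := Measure.addHaarScalarFactor_pos_of_isAddHaarMeasure μ' μ
    exact_mod_cast this
  have hc' : ((c : ℝ) : ℂ) ≠ 0 := Complex.ofReal_ne_zero.2 hc.ne'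
  have hg : weilGauss ψ μ' a = (c : ℂ) * weilGauss ψ μ a := by
    rw [weilGauss_eq_gaussBall μ' hd hv hv₂ hn₀, weilGauss_eq_gaussBall μ hd hv hv₂ hn₀, gaussBall_def, hμ',
      ← gaussBall_def, gaussBall_smul_measure]
  rw [weilIndex, weilIndex, hg, norm_mul, Complex.norm_real, Real.norm_of_nonneg hc.le, Complex.ofReal_mul,
    mul_div_mul_left _ _ hc']

end Index

end Literature.NumberTheory.Weil1964
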